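import Summits.RiemannHypothesis.RiemannHypothesis.Theorems.WeilGroundStateGroundStatesConvergeToXiRenormBlowup
import HarnessLib

/-!
# `WeilGroundState.GroundStatesConvergeToXi` — Plancherel lower bound on the renormalisation
constants and the MEAN of a crux witness (crux item stmt-RiemannHypothesis-1527, route
route-RiemannHypothesis-WeilGroundState; line `Sketch`, lead c5; `--supports`)

RH-free necessary conditions that EVERY witness `(a_k, u_k, c_k)` of the crux's convergence
clause (`c_k · weilMellin u_k → ξ` locally uniformly on the open strip, `u_k` ground states)
satisfies, all by Plancherel on the critical line (`∫ |𝓕u_k|² = ∫ |u_k|² = 1`, independent of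
the window):

* `eventually_norm_sq_renorm_ge` — **`liminf ‖c_k‖ ≥ ‖Φ‖₂`** (sharp: `‖c_k‖² = ∫|c_k 𝓕u_k|² ≥
  ∫_{[-R,R]} |c_k 𝓕u_k|² ≈ ∫_{[-R,R]} |Ξ|² ≈ ‖Φ‖₂²`); the truncations `Φ𝟙_{[-k-1,k+1]}`,
  `c_k = 1`, of `Negative/ConvergenceClauseNonVacuous` show the constant cannot be improved for
  the convergence clause alone.
* `tendsto_renorm_integral` — the renormalised means converge: `c_k ∫ u_k → ξ(1/2) = ∫ Φ`.
* `eventually_norm_integral_mul_sqrt_le` — hence the MEAN of the normalised ground states of a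
  witness is asymptotically at most `ξ(1/2)/‖Φ‖₂`:  `limsup ‖∫ u_k‖ ≤ ξ(1/2)/‖Φ‖₂` (≈ 0.864; the
  crux numerics r1-k2 measure `∫ u_a = 0.742, 0.793, 0.833, 0.853, 0.863` at `a ≤ 1.24`).
* `riemannHypothesis_of_cruxWitness_frequently_norm_integral_ge` — **a crux witness whose
  normalised ground states have means bounded away from zero (infinitely often) proves RH**
  (`‖c_k‖ = ‖c_k∫u_k‖/‖∫u_k‖` stays bounded, then `riemannHypothesis_of_cruxWitness_norm_le`);
  under `¬RH` every crux witness has `∫ u_k → 0`: the normalised ground states of a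
  counterexample-world witness become mean-free.
No new definitions.
-/

noncomputable section

set_option linter.dupNamespace false

open scoped Topology Real ComplexConjugate FourierTransform
open Filter Set MeasureTheory Complex

namespace Summit.RiemannHypothesis.RiemannHypothesis.Theorems.GroundStatesConvergeToXi

open Literature.NumberTheory.LFunctions

/-! ## Plancherel lower bound on the renormalisation constants -/

/-- Pointwise: if `‖x − y‖ < δ` then `‖y‖² − 2δ‖y‖ ≤ ‖x‖²`. [folklore] -/
theorem norm_sq_sub_le_norm_sq_of_norm_sub_lt {x y : ℂ} {δ : ℝ} (h : ‖x - y‖ < δ) :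
    ‖y‖ ^ 2 - 2 * δ * ‖y‖ ≤ ‖x‖ ^ 2 := by
  have hδ : 0 ≤ δ := (norm_nonneg _).trans h.le
  have h1 : ‖y‖ - δ ≤ ‖x‖ := by
    have := norm_sub_norm_le y x
    rw [norm_sub_rev] at this
    linarith
  rcases le_or_gt δ ‖y‖ with h2 | h2
  · nlinarith [pow_le_pow_left₀ (sub_nonneg.2 h2) h1 2]
  · nlinarith [norm_nonneg x, norm_nonneg y]

/-- **`liminf ‖c_k‖² ≥ ‖Φ‖₂²` for every witness of the crux's convergence clause (RH-free).**
If `u_k` are ground states and `c_k · weilMellin u_k → ξ` locally uniformly on the open strip,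
then for every `ε > 0`, eventually `‖c_k‖² ≥ ∫‖Φ‖² − ε`.  Proof: Plancherel gives
`∫ |c_k 𝓕u_k|² = |c_k|² ∫|u_k|² = |c_k|²`; on a frequency window `[-R, R]` carrying all but `ε/2`
of `∫|Ξ|² = ∫|Φ|²`, `c_k 𝓕u_k → Ξ(2π·)` uniformly, so `∫_{[-R,R]} |c_k 𝓕u_k|² ≥ ∫_{[-R,R]}|Ξ|² − ε/2`
for large `k`. [folklore] -/
theorem eventually_norm_sq_renorm_ge {a : ℕ → ℝ} {u : ℕ → ℝ → ℂ} {c : ℕ → ℂ}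
    (hu : ∀ k, IsWeilGroundState (a k) (u k))
    (hlim : TendstoLocallyUniformlyOn (fun k s => c k * weilMellin (u k) s) riemannXi atTop
      {s : ℂ | 0 < s.re ∧ s.re < 1}) {ε : ℝ} (hε : 0 < ε) :
    ∀ᶠ k in atTop, (∫ t : ℝ, ‖(2 : ℂ) * LagariasMontague.Psic (2 * t)‖ ^ 2) - ε ≤ ‖c k‖ ^ 2 := by
  obtain ⟨hgi, hJ, -⟩ := integral_norm_sq_riemannXi_eq_and_pos
  set g : ℝ → ℝ := fun ξ => ‖riemannXi (1 / 2 + ((2 * π * ξ : ℝ) : ℂ) * I)‖ ^ 2 with hgdef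
  set J : ℝ := ∫ ξ, g ξ with hJdef
  set B : ℝ := LagariasMontague.fourierDecayConst with hBdef
  have hB0 : 0 ≤ B := fourierDecayConst_nonneg
  -- a frequency window `[-R, R]` carrying all but `ε/2` of `J`
  have hcompl : ∀ n : ℕ, ∫ ξ in (Icc (-(n : ℝ)) n)ᶜ, g ξ = J - ∫ ξ in Icc (-(n : ℝ)) n, g ξ := by
    intro n
    have := integral_add_compl (measurableSet_Icc (a := -(n : ℝ)) (b := n)) hgi
    rw [hJdef]; linarith
  have htail : Tendsto (fun n : ℕ => ∫ ξ in (Icc (-(n : ℝ)) n)ᶜ, g ξ) atTop (𝓝 0) := by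
    have hmono : Monotone fun n : ℕ => Icc (-(n : ℝ)) n := by
      intro m n hmn
      have h : (m : ℝ) ≤ n := by exact_mod_cast hmn
      exact Icc_subset_Icc (by linarith) h
    have hU : (⋃ n : ℕ, Icc (-(n : ℝ)) n) = univ := by
      refine eq_univ_of_forall fun x => ?_
      obtain ⟨n, hn⟩ := exists_nat_ge |x|
      exact mem_iUnion.2 ⟨n, abs_le.1 hn⟩
    have h1 := tendsto_setIntegral_of_monotone (μ := volume) (f := g)
      (fun n : ℕ => (measurableSet_Icc : MeasurableSet (Icc (-(n : ℝ)) n))) hmono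
      (by rw [hU]; exact hgi.integrableOn)
    rw [hU, setIntegral_univ] at h1
    have h2 := (tendsto_const_nhds (x := J)).sub h1
    rw [← hJdef, sub_self] at h2
    refine h2.congr fun n => ?_
    rw [hcompl n]
  obtain ⟨R, hRtail, hR1⟩ := ((htail.eventually (ge_mem_nhds (half_pos hε))).and
    (eventually_ge_atTop 1)).exists
  have hR0 : (0 : ℝ) ≤ R := by positivity
  set S : Set ℝ := Icc (-(R : ℝ)) R with hSdef
  have hS : MeasurableSet S := measurableSet_Icc
  have hgS : J - ε / 2 ≤ ∫ ξ in S, g ξ := by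
    have h1 := hcompl R
    have h2 : ∫ ξ in Sᶜ, g ξ ≤ ε / 2 := hRtail
    rw [hSdef]; linarith
  -- uniform closeness on the window
  set δ : ℝ := ε / (2 * (4 * R * B + 1)) with hδdef
  have hδ0 : 0 < δ := by positivity
  filter_upwards [eventually_norm_fourier_sub_riemannXi_lt hlim R hδ0] with k hk
  -- Plancherel for `u_k`
  have hF2 : ∫ ξ, ‖𝓕 (u k) ξ‖ ^ 2 = 1 := by
    rw [Literature.Analysis.FunctionSpaces.integral_norm_sq_fourierIntegral_eq (hu k).integrable
      (hu k).memLp, (hu k).integral_norm_sq]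
  have hF2i : Integrable fun ξ => ‖𝓕 (u k) ξ‖ ^ 2 := by
    have h := Literature.Analysis.FunctionSpaces.memLp_two_fourierIntegral (hu k).integrable
      (hu k).memLp
    exact (memLp_two_iff_integrable_sq_norm h.1).1 h
  have hcF2i : Integrable fun ξ => ‖c k * 𝓕 (u k) ξ‖ ^ 2 := by
    refine (hF2i.const_mul (‖c k‖ ^ 2)).congr (ae_of_all _ fun ξ => ?_)
    simp only [norm_mul, mul_pow]
  have htot : ∫ ξ, ‖c k * 𝓕 (u k) ξ‖ ^ 2 = ‖c k‖ ^ 2 := by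
    simp only [norm_mul, mul_pow]
    rw [integral_const_mul, hF2, mul_one]
  -- on the window: `‖c 𝓕u‖² ≥ g − 2δB`
  have hpt : ∀ ξ ∈ S, g ξ - 2 * δ * B ≤ ‖c k * 𝓕 (u k) ξ‖ ^ 2 := by
    intro ξ hξ
    have h1 := norm_sq_sub_le_norm_sq_of_norm_sub_lt (hk ξ hξ)
    have h2 : ‖riemannXi (1 / 2 + ((2 * π * ξ : ℝ) : ℂ) * I)‖ ≤ B := norm_riemannXi_criticalLine_le _
    have h3 : 2 * δ * ‖riemannXi (1 / 2 + ((2 * π * ξ : ℝ) : ℂ) * I)‖ ≤ 2 * δ * B :=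
      mul_le_mul_of_nonneg_left h2 (by positivity)
    rw [hgdef]
    simp only
    linarith
  have hwin : (∫ ξ in S, g ξ) - 2 * δ * B * (2 * R) ≤ ∫ ξ in S, ‖c k * 𝓕 (u k) ξ‖ ^ 2 := by
    have hconst : IntegrableOn (fun _ : ℝ => 2 * δ * B) S := by
      rw [integrableOn_const_iff]
      exact Or.inr measure_Icc_lt_top
    have h1 : ∫ ξ in S, (g ξ - 2 * δ * B) ≤ ∫ ξ in S, ‖c k * 𝓕 (u k) ξ‖ ^ 2 :=
      setIntegral_mono_on (hgi.integrableOn.sub hconst) hcF2i.integrableOn hS hpt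
    have h2 : ∫ ξ in S, (g ξ - 2 * δ * B) = (∫ ξ in S, g ξ) - 2 * δ * B * (2 * R) := by
      rw [integral_sub hgi.integrableOn hconst, setIntegral_const, measureReal_def, hSdef,
        Real.volume_Icc, ENNReal.toReal_ofReal (by linarith)]
      simp only [smul_eq_mul]
      ring
    linarith
  have hle : ∫ ξ in S, ‖c k * 𝓕 (u k) ξ‖ ^ 2 ≤ ‖c k‖ ^ 2 := by
    rw [← htot]
    exact setIntegral_le_integral hcF2i (ae_of_all _ fun _ => by positivity)
  have hsmall : 2 * δ * B * (2 * R) ≤ ε / 2 := by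
    rw [hδdef]
    rw [show 2 * (ε / (2 * (4 * R * B + 1))) * B * (2 * R) = ε * (4 * R * B) / (2 * (4 * R * B + 1)) by
      field_simp; ring]
    rw [div_le_div_iff₀ (by positivity) (by norm_num : (0 : ℝ) < 2)]
    nlinarith [mul_nonneg hR0 hB0]
  rw [← hJ]
  linarith

/-- **`liminf ‖c_k‖ ≥ ‖Φ‖₂`**: for every `M` with `M² < ∫‖Φ‖²`, eventually `M ≤ ‖c_k‖`. [folklore] -/
theorem eventually_norm_renorm_ge {a : ℕ → ℝ} {u : ℕ → ℝ → ℂ} {c : ℕ → ℂ}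
    (hu : ∀ k, IsWeilGroundState (a k) (u k))
    (hlim : TendstoLocallyUniformlyOn (fun k s => c k * weilMellin (u k) s) riemannXi atTop
      {s : ℂ | 0 < s.re ∧ s.re < 1}) {M : ℝ}
    (hM : M ^ 2 < ∫ t : ℝ, ‖(2 : ℂ) * LagariasMontague.Psic (2 * t)‖ ^ 2) :
    ∀ᶠ k in atTop, M ≤ ‖c k‖ := by
  filter_upwards [eventually_norm_sq_renorm_ge hu hlim (sub_pos.2 hM)] with k hk
  have h1 : M ^ 2 ≤ ‖c k‖ ^ 2 := by linarith
  have h2 := Real.sqrt_le_sqrt h1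
  rw [Real.sqrt_sq_eq_abs, Real.sqrt_sq (norm_nonneg _)] at h2
  exact (le_abs_self M).trans h2

/-! ## The renormalised means converge to `ξ(1/2) = ∫ Φ` -/

/-- `weilMellin v (1/2) = ∫ v` (the Mellin weight is `e^{0·t} = 1` at the centre). [folklore] -/
theorem weilMellin_one_half (v : ℝ → ℂ) : weilMellin v (1 / 2) = ∫ t, v t := by
  unfold weilMellin
  refine integral_congr_ae (ae_of_all _ fun t => ?_)
  simp

/-- `ξ(1/2) = ∫ Φ` (Riemann's kernel has total mass `ξ(1/2)`; `Φ̂ = ξ` at the centre). [folklore] -/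
theorem riemannXi_one_half_eq_integral_phi :
    riemannXi (1 / 2) = ∫ t : ℝ, (2 : ℂ) * LagariasMontague.Psic (2 * t) := by
  rw [← stub_mellinXi stub_psiDecay.1 stub_psiDecay.2 (1 / 2), weilMellin_one_half]

/-- The centre `1/2` lies in the open strip. [folklore] -/
theorem one_half_mem_strip : ((1 / 2 : ℂ)) ∈ {s : ℂ | 0 < s.re ∧ s.re < 1} := by
  constructor <;> norm_num

/-- **The renormalised means of a witness converge to `ξ(1/2)`**: if `c_k · weilMellin u_k → ξ`
locally uniformly on the open strip then `c_k ∫ u_k → ξ(1/2) = ∫ Φ` (evaluate at the centre).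
[folklore] -/
theorem tendsto_renorm_integral {u : ℕ → ℝ → ℂ} {c : ℕ → ℂ}
    (hlim : TendstoLocallyUniformlyOn (fun k s => c k * weilMellin (u k) s) riemannXi atTop
      {s : ℂ | 0 < s.re ∧ s.re < 1}) :
    Tendsto (fun k => c k * ∫ t, u k t) atTop (𝓝 (riemannXi (1 / 2))) := by
  have h := hlim.tendsto_at one_half_mem_strip
  simpa only [weilMellin_one_half] using h

/-- Eventually `‖c_k ∫ u_k‖ ≤ ‖ξ(1/2)‖ + η`. [folklore] -/
theorem eventually_norm_renorm_integral_le {u : ℕ → ℝ → ℂ} {c : ℕ → ℂ}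
    (hlim : TendstoLocallyUniformlyOn (fun k s => c k * weilMellin (u k) s) riemannXi atTop
      {s : ℂ | 0 < s.re ∧ s.re < 1}) {η : ℝ} (hη : 0 < η) :
    ∀ᶠ k in atTop, ‖c k * ∫ t, u k t‖ ≤ ‖riemannXi (1 / 2)‖ + η := by
  have h := (tendsto_renorm_integral hlim).norm
  filter_upwards [h.eventually (Iio_mem_nhds (show ‖riemannXi (1 / 2)‖ < ‖riemannXi (1 / 2)‖ + η by
    linarith))] with k hk
  exact hk.le

/-! ## The mean of the normalised ground states of a witness -/

/-- **Crude bound on the means**: eventually `‖∫ u_k‖ ≤ 2(‖ξ(1/2)‖ + 1)/‖Φ‖₂` for every witness of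
the convergence clause (`‖c_k‖ ≥ ‖Φ‖₂/2` eventually and `‖c_k ∫ u_k‖ ≤ ‖ξ(1/2)‖ + 1`). [folklore] -/
theorem eventually_norm_integral_le {a : ℕ → ℝ} {u : ℕ → ℝ → ℂ} {c : ℕ → ℂ}
    (hu : ∀ k, IsWeilGroundState (a k) (u k))
    (hlim : TendstoLocallyUniformlyOn (fun k s => c k * weilMellin (u k) s) riemannXi atTop
      {s : ℂ | 0 < s.re ∧ s.re < 1}) :
    ∀ᶠ k in atTop, ‖∫ t, u k t‖ ≤ 2 * (‖riemannXi (1 / 2)‖ + 1) /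
      Real.sqrt (∫ t : ℝ, ‖(2 : ℂ) * LagariasMontague.Psic (2 * t)‖ ^ 2) := by
  obtain ⟨-, hP⟩ := integral_phi_mul_phi_eq_and_pos
  set P : ℝ := ∫ t : ℝ, ‖(2 : ℂ) * LagariasMontague.Psic (2 * t)‖ ^ 2 with hPdef
  have hsP : 0 < Real.sqrt P := Real.sqrt_pos.2 hP
  have hM : (Real.sqrt P / 2) ^ 2 < P := by
    rw [div_pow, Real.sq_sqrt hP.le]; linarith
  filter_upwards [eventually_norm_renorm_ge hu hlim hM, eventually_norm_renorm_integral_le hlim one_pos]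
    with k hck hk
  have hcpos : 0 < ‖c k‖ := lt_of_lt_of_le (by positivity) hck
  rw [norm_mul] at hk
  rw [le_div_iff₀ hsP]
  nlinarith [norm_nonneg (∫ t, u k t)]

/-- **The MEAN of a witness is asymptotically at most `ξ(1/2)/‖Φ‖₂` (RH-free necessary condition
of the crux).**  For every witness of the convergence clause and every `η > 0`, eventually
`‖∫ u_k‖ · ‖Φ‖₂ ≤ ‖ξ(1/2)‖ + η`; i.e. `limsup ‖∫ u_k‖ ≤ ξ(1/2)/‖Φ‖₂ = ∫Φ/‖Φ‖₂` (≈ 0.864), with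
equality forced for the minimal renormalisation `‖c_k‖ → ‖Φ‖₂`.  (Crux numerics r1-k2:
`∫ u_a = 0.742, 0.793, 0.833, 0.853, 0.863` for `a = 0.35, …, 1.24`, increasing.) [folklore] -/
theorem eventually_norm_integral_mul_sqrt_le {a : ℕ → ℝ} {u : ℕ → ℝ → ℂ} {c : ℕ → ℂ}
    (hu : ∀ k, IsWeilGroundState (a k) (u k))
    (hlim : TendstoLocallyUniformlyOn (fun k s => c k * weilMellin (u k) s) riemannXi atTop
      {s : ℂ | 0 < s.re ∧ s.re < 1}) {η : ℝ} (hη : 0 < η) :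
    ∀ᶠ k in atTop, ‖∫ t, u k t‖ * Real.sqrt (∫ t : ℝ, ‖(2 : ℂ) * LagariasMontague.Psic (2 * t)‖ ^ 2) ≤
      ‖riemannXi (1 / 2)‖ + η := by
  obtain ⟨-, hP⟩ := integral_phi_mul_phi_eq_and_pos
  set P : ℝ := ∫ t : ℝ, ‖(2 : ℂ) * LagariasMontague.Psic (2 * t)‖ ^ 2 with hPdef
  set X : ℝ := ‖riemannXi (1 / 2)‖ with hXdef
  have hsP : 0 < Real.sqrt P := Real.sqrt_pos.2 hP
  set B₀ : ℝ := 2 * (X + 1) / Real.sqrt P with hB₀def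
  have hB₀ : 0 ≤ B₀ := by positivity
  set θ : ℝ := min (Real.sqrt P / 2) (η / 2 / (B₀ + 1)) with hθdef
  have hθ0 : 0 < θ := by positivity
  have hθ1 : θ ≤ Real.sqrt P / 2 := min_le_left _ _
  have hθ2 : θ * (B₀ + 1) ≤ η / 2 := by
    have := min_le_right (Real.sqrt P / 2) (η / 2 / (B₀ + 1))
    rwa [hθdef.symm, le_div_iff₀ (by positivity)] at this
  have hM : (Real.sqrt P - θ) ^ 2 < P := by
    have h1 : (Real.sqrt P - θ) ^ 2 = P - θ * (2 * Real.sqrt P - θ) := by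
      rw [sub_sq, Real.sq_sqrt hP.le]; ring
    rw [h1]
    have h2 : 0 < 2 * Real.sqrt P - θ := by linarith
    nlinarith
  filter_upwards [eventually_norm_renorm_ge hu hlim hM, eventually_norm_renorm_integral_le hlim
    (half_pos hη), eventually_norm_integral_le hu hlim] with k hck hk hB
  rw [norm_mul] at hk
  have hB' : ‖∫ t, u k t‖ ≤ B₀ := hB
  have h1 : ‖∫ t, u k t‖ * Real.sqrt P = ‖∫ t, u k t‖ * (Real.sqrt P - θ) + θ * ‖∫ t, u k t‖ := by
    ring
  rw [h1]
  have h2 : ‖∫ t, u k t‖ * (Real.sqrt P - θ) ≤ ‖c k‖ * ‖∫ t, u k t‖ := by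
    rw [mul_comm]
    exact mul_le_mul_of_nonneg_right hck (norm_nonneg _)
  have h3 : θ * ‖∫ t, u k t‖ ≤ θ * (B₀ + 1) := mul_le_mul_of_nonneg_left (by linarith) hθ0.le
  linarith

/-! ## A witness with non-vanishing means proves RH -/

/-- **A crux witness whose normalised ground states have means bounded away from zero proves
RH (RH-free mechanism).**  Let `a_k → ∞`, `u_k` ground states, `c_k û_k → ξ` locally uniformly on
the open strip, and `‖∫ u_k‖ ≥ m > 0` for infinitely many `k`.  Then `‖c_k‖ ≤ (‖ξ(1/2)‖ + 1)/m`
along those `k` (`c_k ∫u_k → ξ(1/2)`), and bounded renormalisation constants along a subsequence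
prove RH (`riemannHypothesis_of_cruxWitness_norm_le`, Plancherel + overlap–energy). [folklore] -/
theorem riemannHypothesis_of_cruxWitness_frequently_norm_integral_ge {a : ℕ → ℝ} {u : ℕ → ℝ → ℂ}
    {c : ℕ → ℂ} (ha : Tendsto a atTop atTop) (hu : ∀ k, IsWeilGroundState (a k) (u k))
    (hlim : TendstoLocallyUniformlyOn (fun k s => c k * weilMellin (u k) s) riemannXi atTop
      {s : ℂ | 0 < s.re ∧ s.re < 1})
    (hm : ∃ m : ℝ, 0 < m ∧ ∃ᶠ k in atTop, m ≤ ‖∫ t, u k t‖) : RiemannHypothesis := by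
  obtain ⟨m, hm0, hmf⟩ := hm
  refine riemannHypothesis_of_cruxWitness_norm_le ha hu hlim ⟨(‖riemannXi (1 / 2)‖ + 1) / m, ?_⟩
  refine (hmf.and_eventually (eventually_norm_renorm_integral_le hlim one_pos)).mono fun k hk => ?_
  obtain ⟨hmk, hk⟩ := hk
  rw [norm_mul] at hk
  rw [le_div_iff₀ hm0]
  calc ‖c k‖ * m ≤ ‖c k‖ * ‖∫ t, u k t‖ := mul_le_mul_of_nonneg_left hmk (norm_nonneg _)
    _ ≤ ‖riemannXi (1 / 2)‖ + 1 := hk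

/-- **Under `¬RH`, the normalised ground states of every crux witness become mean-free**:
`∫ u_k → 0` (`‖c_k‖ → ∞` by `tendsto_norm_atTop_of_not_riemannHypothesis` while
`c_k ∫ u_k → ξ(1/2)`). [folklore] -/
theorem tendsto_integral_zero_of_not_riemannHypothesis (hRH : ¬ RiemannHypothesis)
    {a : ℕ → ℝ} {u : ℕ → ℝ → ℂ} {c : ℕ → ℂ}
    (ha : Tendsto a atTop atTop) (hu : ∀ k, IsWeilGroundState (a k) (u k))
    (hlim : TendstoLocallyUniformlyOn (fun k s => c k * weilMellin (u k) s) riemannXi atTop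
      {s : ℂ | 0 < s.re ∧ s.re < 1}) :
    Tendsto (fun k => ∫ t, u k t) atTop (𝓝 0) := by
  rw [tendsto_zero_iff_norm_tendsto_zero]
  by_contra h
  have h' : ∃ m : ℝ, 0 < m ∧ ∃ᶠ k in atTop, m ≤ ‖∫ t, u k t‖ := by
    by_contra h2
    push Not at h2
    apply h
    rw [Metric.tendsto_nhds]
    intro ε hε
    filter_upwards [h2 ε hε] with k hk
    rwa [dist_zero_right, Real.norm_of_nonneg (norm_nonneg _)]
  exact hRH (riemannHypothesis_of_cruxWitness_frequently_norm_integral_ge ha hu hlim h')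

/-- **The crux, restricted to witnesses whose normalised ground states keep a non-vanishing mean,
implies RH** (verbatim clauses of `GroundStatesConvergeToXi` plus
`∃ m > 0, ∃ᶠ k, m ≤ ‖∫ u_k‖`). [folklore] -/
theorem riemannHypothesis_of_groundStatesConvergeToXi_frequently_norm_integral_ge
    (h : ∃ a : ℕ → ℝ, ∃ u : ℕ → ℝ → ℂ, ∃ c : ℕ → ℂ, Tendsto a atTop atTop ∧
      (∀ k, 0 < a k ∧ c k ≠ 0 ∧ MemLp (u k) 2 ∧ ∃ g : ℕ → ℝ → ℂ,
        (∀ n, IsWeilTest (g n) ∧ tsupport (g n) ⊆ Icc (-(a k)) (a k) ∧ ∫ t, ‖g n t‖ ^ 2 = (1 : ℝ)) ∧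
        Tendsto (fun n => (weilQuadratic (g n)).re) atTop (𝓝 (weilGroundEnergy (a k))) ∧
        Tendsto (fun n => ∫ t, ‖g n t - u k t‖ ^ 2) atTop (𝓝 0)) ∧
      TendstoLocallyUniformlyOn (fun k s => c k * weilMellin (u k) s) riemannXi atTop
        {s : ℂ | 0 < s.re ∧ s.re < 1} ∧
      ∃ m : ℝ, 0 < m ∧ ∃ᶠ k in atTop, m ≤ ‖∫ t, u k t‖) :
    RiemannHypothesis := by
  obtain ⟨a, u, c, ha, hk, hlim, hm⟩ := h
  exact riemannHypothesis_of_cruxWitness_frequently_norm_integral_ge ha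
    (fun k => ⟨(hk k).2.2.1, (hk k).2.2.2⟩) hlim hm

end Summit.RiemannHypothesis.RiemannHypothesis.Theorems.GroundStatesConvergeToXi

end
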